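import Mathlib
import HarnessLib
import Literature.MathematicalPhysics.QuantumLattice.FermiRG.BGM2003Sectors
import Summits.HubbardSuperconductivity.HubbardSuperconductivity.Theorems.KLProgrammeH10TwoPointLimitPerturbedFermiRadiusAccel
import Summits.HubbardSuperconductivity.HubbardSuperconductivity.Theorems.KLProgrammePerturbedFermiCurveDefs

/-!
# Route `KLProgramme` — K1/K3 (stmt-HubbardSuperconductivity-19938 / 20437), located item «(L−3)-FRAME-UNIFORM-c», datum (u2):
# the NORMAL ANGLE of the perturbed Fermi curve is Lipschitz on the torus with an EXPLICIT constant, and obeys the half-turn law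

Cell gate-hubbard-kl, seat p4 (C5a), g11.  `FermiRG.BGM2003.lemma31_sectorCounting_of_constants` (this lineage's explicit-constant form of
BGM 2003 Lemma 3.1, `Literature/…/FermiRG/BGM2003SectorCountingProof.lean`) consumes, among its geometric data, the Lipschitz constant `c₂` of the
normal angle `α(θ) = θ − arctan(u′/u)` on `𝕋¹` and the half-turn law `α(θ + π) = α(θ) + π` (BGM 2003 Lemma 7.1 (A1.9)).  For a root selection `u`
of the perturbed curve `{ε₀ + δ = μ}` (`δ ∈ C²`, `|δ| ≤ κ₀`, `‖Dδ‖ ≤ κ₁ < Dt_min`, `‖D²δ‖ ≤ κ₂` on the closed square, `[μ − κ₀, μ + κ₀] ⊂ [a, b]`) both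
hold UNIFORMLY, with `c₂ = 2 + U₂/u_min` (`U₂` = the acceleration bound `abs_second_deriv_le`):

* §1 three torus-distance facts (`FermiRG.torusDist`): invariance under `2πℤ`, `≤ |·|`, attained representative;
* §2 `hasDerivAt_normalAngleFn`, `abs_deriv_normalAngleFn_le` (`|α′| ≤ 2 + |u″|/u`), `abs_normalAngleFn_sub_le` (real-line Lipschitz),
  `normalAngleFn_add_int_mul_two_pi`, `normalAngleFn_add_pi` (even `δ`), **`torusDist_normalAngleFn_le`** (torus Lipschitz);
* §3 in BGM 2003's vocabulary for `u₂ θ e := perturbedFermiRadius δ (μ + e) θ`: **`normalAngle_perturbed_lipschitz`**, **`normalAngle_perturbed_add_pi`**.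

Everything is PROVED; no definitions, no named facts.  References: BGM 2003 §7.1 Lemma 7.1 (A1.9) [cite: BenfattoGiulianiMastropietro2003];
BGM 2006 §2.4 Lemma 2.1 (2.40)–(2.41) [cite: BenfattoGiulianiMastropietro2006].
-/

noncomputable section

namespace Summit.HubbardSuperconductivity.HubbardSuperconductivity.Theorems.PerturbedFermiCurve

set_option linter.dupNamespace false -- summit = problem name (single-conjunct summit), D-0017

open Real Set
open Literature.MathematicalPhysics.QuantumLattice Literature.MathematicalPhysics.QuantumLattice.BandSectorCounting
open Literature.MathematicalPhysics.QuantumLattice.FermiRG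

/-! ## §1 Torus distance -/

/-- `‖x + 2πk‖_{𝕋¹} = ‖x‖_{𝕋¹}`. [folklore] -/
theorem torusDist_add_int_mul_two_pi (x : ℝ) (k : ℤ) : torusDist (x + k * (2 * π)) = torusDist x := by
  unfold torusDist
  rw [AddCircle.coe_add]
  have : (((k : ℝ) * (2 * π) : ℝ) : AddCircle (2 * π)) = 0 := by
    rw [AddCircle.coe_eq_zero_iff]
    exact ⟨k, by simp [zsmul_eq_mul]⟩
  rw [this, add_zero]

/-- `‖x‖_{𝕋¹} ≤ |x|`. [folklore] -/
theorem torusDist_le_abs_self (x : ℝ) : torusDist x ≤ |x| :=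
  QuotientAddGroup.norm_mk_le_norm.trans (le_of_eq (Real.norm_eq_abs _))

/-- The torus distance is attained by a representative: `‖x‖_{𝕋¹} = |x + 2πk|` for some `k ∈ ℤ`. [folklore] -/
theorem exists_torusDist_eq_abs (x : ℝ) : ∃ k : ℤ, torusDist x = |x + k * (2 * π)| := by
  refine ⟨-round ((2 * π)⁻¹ * x), ?_⟩
  unfold torusDist
  rw [AddCircle.norm_eq]
  congr 1
  push_cast
  ring

/-! ## §2 The normal angle of a positive `C²` radius function -/

/-- The derivative of a periodic function is periodic. [folklore] -/
theorem deriv_periodic {f : ℝ → ℝ} {c : ℝ} (hf : Function.Periodic f c) : Function.Periodic (deriv f) c := by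
  intro x
  have h : (fun y => f (y + c)) = f := funext hf
  have := deriv_comp_add_const f c (x := x)
  rw [h] at this
  exact this.symm

/-- **The derivative of the normal angle** `α(θ) = θ − arctan(u′(θ)/u(θ))` of a twice differentiable positive radius function:
`α′ = 1 − ((u″u − u′²)/u²)/(1 + (u′/u)²)`. [cite: BenfattoGiulianiMastropietro2003, §7.1 (A1.10)] -/
theorem hasDerivAt_normalAngleFn {u : ℝ → ℝ} {θ : ℝ} (hu0 : 0 < u θ) (h1 : HasDerivAt u (deriv u θ) θ)
    (h2 : HasDerivAt (deriv u) (deriv (deriv u) θ) θ) :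
    HasDerivAt (fun ϑ => ϑ - Real.arctan (deriv u ϑ / u ϑ))
      (1 - (deriv (deriv u) θ * u θ - deriv u θ * deriv u θ) / u θ ^ 2 / (1 + (deriv u θ / u θ) ^ 2)) θ := by
  have hq : HasDerivAt (fun ϑ => deriv u ϑ / u ϑ) ((deriv (deriv u) θ * u θ - deriv u θ * deriv u θ) / u θ ^ 2) θ :=
    h2.div h1 hu0.ne'
  have ha := (Real.hasDerivAt_arctan (deriv u θ / u θ)).comp θ hq
  have h := (hasDerivAt_id θ).sub ha
  have h' : HasDerivAt (fun ϑ => ϑ - Real.arctan (deriv u ϑ / u ϑ))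
      (1 - 1 / (1 + (deriv u θ / u θ) ^ 2) * ((deriv (deriv u) θ * u θ - deriv u θ * deriv u θ) / u θ ^ 2)) θ := h
  refine h'.congr_deriv ?_
  ring

section Root

variable {a b : ℝ} (B : BandBounds a b) {δ : (Fin 2 → ℝ) → ℝ} (hδs : ContDiff ℝ 2 δ)
  {κ₀ κ₁ κ₂ μ : ℝ} (hδ : ∀ k : Fin 2 → ℝ, (∀ i, |k i| ≤ π) → |δ k| ≤ κ₀) (hlo : a ≤ μ - κ₀) (hhi : μ + κ₀ ≤ b)
  (hκ : ∀ k : Fin 2 → ℝ, (∀ i, |k i| ≤ π) → ‖fderiv ℝ δ k‖ ≤ κ₁) (hκ₁ : κ₁ < B.Dtmin)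
  (hκ₂ : ∀ k : Fin 2 → ℝ, (∀ i, |k i| ≤ π) → ‖fderiv ℝ (fderiv ℝ δ) k‖ ≤ κ₂)
  {u : ℝ → ℝ} (hu : ∀ θ, IsBandFermiRadius (μ - δ (u θ • dir θ)) θ (u θ))
include B hδs hδ hlo hhi hκ hκ₁ hκ₂ hu

/-- **`|α′| ≤ 2 + U₂/u_min`** on the perturbed curve, `U₂` the acceleration bound of `abs_second_deriv_le`.
[cite: BenfattoGiulianiMastropietro2003, §7.1 Lemma 7.1 (A1.9)] -/
theorem abs_deriv_normalAngleFn_le (θ : ℝ) :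
    |deriv (fun ϑ => ϑ - Real.arctan (deriv u ϑ / u ϑ)) θ| ≤
      2 + ((4 + κ₂) * (B.smax + κ₁ * (π * Real.sqrt 2 + 2 * B.smax) / (B.Dtmin - κ₁)) ^ 2 +
        (8 + 2 * κ₁) * ((4 + κ₁) * (π * Real.sqrt 2) / (B.Dtmin - κ₁)) + (4 + κ₁) * (π * Real.sqrt 2)) / (B.Dtmin - κ₁) / B.umin := by
  have h2ne : (2 : WithTop ℕ∞) ≠ 0 := by norm_num
  set U2 := ((4 + κ₂) * (B.smax + κ₁ * (π * Real.sqrt 2 + 2 * B.smax) / (B.Dtmin - κ₁)) ^ 2 +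
        (8 + 2 * κ₁) * ((4 + κ₁) * (π * Real.sqrt 2) / (B.Dtmin - κ₁)) + (4 + κ₁) * (π * Real.sqrt 2)) / (B.Dtmin - κ₁) with hU2
  have hu2 : ContDiff ℝ 2 u := contDiff_of_isRoot B hδs h2ne hδ hlo hhi hκ hκ₁ hu
  have hd1 : Differentiable ℝ u := hu2.differentiable h2ne
  have hd2 : Differentiable ℝ (deriv u) := by
    have h : ContDiff ℝ ((1 : WithTop ℕ∞) + 1) u := by rw [one_add_one_eq_two]; exact hu2
    exact ((contDiff_succ_iff_deriv.1 h).2.2).differentiable one_ne_zero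
  have hupos : 0 < u θ := (mem_Ioo_of_shifted B hδ hlo hhi (hu θ)).1
  have humin : B.umin ≤ u θ := umin_le_of_shifted B hδ hlo hhi (hu θ)
  have hum0 := B.umin_pos
  have hder := hasDerivAt_normalAngleFn hupos (hd1 θ).hasDerivAt (hd2 θ).hasDerivAt
  rw [hder.deriv]
  have hU := abs_second_deriv_le B hδs hδ hlo hhi hκ hκ₁ hκ₂ hu θ
  rw [← hU2] at hU
  -- write `α′ = 1 − (u″u − u′²)/(u² + u′²)`
  set p := deriv u θ with hp
  set q := deriv (deriv u) θ with hq
  have hden : 0 < u θ ^ 2 + p ^ 2 := by positivity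
  have e : 1 - (q * u θ - p * p) / u θ ^ 2 / (1 + (p / u θ) ^ 2) = 1 - (q * u θ - p * p) / (u θ ^ 2 + p ^ 2) := by
    field_simp
  rw [e]
  -- `|(u″u − u′²)/(u² + u′²)| ≤ |u″|/u + 1`
  have h1 : |(q * u θ - p * p) / (u θ ^ 2 + p ^ 2)| ≤ |q| / u θ + 1 := by
    rw [abs_div, abs_of_pos hden, div_le_iff₀ hden]
    have hqu : |q * u θ| ≤ |q| / u θ * (u θ ^ 2 + p ^ 2) := by
      rw [abs_mul, abs_of_pos hupos]
      have : |q| * u θ = |q| / u θ * u θ ^ 2 := by field_simp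
      rw [this]
      exact mul_le_mul_of_nonneg_left (by nlinarith) (by positivity)
    calc |q * u θ - p * p| ≤ |q * u θ| + |p * p| := abs_sub _ _
      _ ≤ |q| / u θ * (u θ ^ 2 + p ^ 2) + 1 * (u θ ^ 2 + p ^ 2) := by
          refine add_le_add hqu ?_
          rw [abs_mul_self, one_mul]; nlinarith
      _ = (|q| / u θ + 1) * (u θ ^ 2 + p ^ 2) := by ring
  have h2 : |q| / u θ ≤ U2 / B.umin := by
    have hU20 : 0 ≤ U2 := (abs_nonneg _).trans hU
    calc |q| / u θ ≤ U2 / u θ := div_le_div_of_nonneg_right hU hupos.le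
      _ ≤ U2 / B.umin := div_le_div_of_nonneg_left hU20 hum0 humin
  calc |1 - (q * u θ - p * p) / (u θ ^ 2 + p ^ 2)| ≤ |(1 : ℝ)| + |(q * u θ - p * p) / (u θ ^ 2 + p ^ 2)| := abs_sub _ _
    _ ≤ 1 + (|q| / u θ + 1) := by rw [abs_one]; exact add_le_add le_rfl h1
    _ ≤ 2 + U2 / B.umin := by linarith

/-- **Real-line Lipschitz**: `|α(y) − α(x)| ≤ (2 + U₂/u_min)|y − x|`. [cite: BenfattoGiulianiMastropietro2003, §7.1 Lemma 7.1 (A1.9)] -/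
theorem abs_normalAngleFn_sub_le (x y : ℝ) :
    |(y - Real.arctan (deriv u y / u y)) - (x - Real.arctan (deriv u x / u x))| ≤
      (2 + ((4 + κ₂) * (B.smax + κ₁ * (π * Real.sqrt 2 + 2 * B.smax) / (B.Dtmin - κ₁)) ^ 2 +
        (8 + 2 * κ₁) * ((4 + κ₁) * (π * Real.sqrt 2) / (B.Dtmin - κ₁)) + (4 + κ₁) * (π * Real.sqrt 2)) / (B.Dtmin - κ₁) / B.umin) *
        |y - x| := by
  have h2ne : (2 : WithTop ℕ∞) ≠ 0 := by norm_num
  have hu2 : ContDiff ℝ 2 u := contDiff_of_isRoot B hδs h2ne hδ hlo hhi hκ hκ₁ hu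
  have hd1 : Differentiable ℝ u := hu2.differentiable h2ne
  have hd2 : Differentiable ℝ (deriv u) := by
    have h : ContDiff ℝ ((1 : WithTop ℕ∞) + 1) u := by rw [one_add_one_eq_two]; exact hu2
    exact ((contDiff_succ_iff_deriv.1 h).2.2).differentiable one_ne_zero
  have hdiffα : Differentiable ℝ (fun ϑ => ϑ - Real.arctan (deriv u ϑ / u ϑ)) := fun θ =>
    (hasDerivAt_normalAngleFn (mem_Ioo_of_shifted B hδ hlo hhi (hu θ)).1 (hd1 θ).hasDerivAt (hd2 θ).hasDerivAt).differentiableAt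
  have hbound : ∀ θ ∈ (Set.univ : Set ℝ), ‖deriv (fun ϑ => ϑ - Real.arctan (deriv u ϑ / u ϑ)) θ‖ ≤
      2 + ((4 + κ₂) * (B.smax + κ₁ * (π * Real.sqrt 2 + 2 * B.smax) / (B.Dtmin - κ₁)) ^ 2 +
        (8 + 2 * κ₁) * ((4 + κ₁) * (π * Real.sqrt 2) / (B.Dtmin - κ₁)) + (4 + κ₁) * (π * Real.sqrt 2)) / (B.Dtmin - κ₁) / B.umin :=
    fun θ _ => by rw [Real.norm_eq_abs]; exact abs_deriv_normalAngleFn_le B hδs hδ hlo hhi hκ hκ₁ hκ₂ hu θ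
  have h := convex_univ.norm_image_sub_le_of_norm_deriv_le (fun θ _ => hdiffα θ) hbound (Set.mem_univ x) (Set.mem_univ y)
  rw [Real.norm_eq_abs, Real.norm_eq_abs] at h
  exact h

omit B hδs hδ hlo hhi hκ hκ₁ hκ₂ hu in
/-- `α(θ + 2πk) = α(θ) + 2πk` (the root selection is `2π`-periodic, being unique ray by ray). [folklore] -/
theorem normalAngleFn_add_int_mul_two_pi (hper : Function.Periodic u (2 * π)) (θ : ℝ) (k : ℤ) :
    (θ + k * (2 * π)) - Real.arctan (deriv u (θ + k * (2 * π)) / u (θ + k * (2 * π))) =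
      (θ - Real.arctan (deriv u θ / u θ)) + k * (2 * π) := by
  have h0 : u (θ + k * (2 * π)) = u θ := (hper.int_mul k) θ
  have h1 : deriv u (θ + k * (2 * π)) = deriv u θ := ((deriv_periodic hper).int_mul k) θ
  rw [h0, h1]; ring

omit B hδs hδ hlo hhi hκ hκ₁ hκ₂ hu in
/-- **Half-turn law**: `α(θ + π) = α(θ) + π` when the root selection is `π`-periodic (even `δ`). [cite: BenfattoGiulianiMastropietro2003, §7.1 Lemma 7.1 (A1.9)] -/
theorem normalAngleFn_add_pi (hper : Function.Periodic u π) (θ : ℝ) :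
    (θ + π) - Real.arctan (deriv u (θ + π) / u (θ + π)) = (θ - Real.arctan (deriv u θ / u θ)) + π := by
  rw [hper θ, deriv_periodic hper θ]; ring

/-- **Torus Lipschitz**: `‖α(θ₂) − α(θ₁)‖_{𝕋¹} ≤ (2 + U₂/u_min)·‖θ₂ − θ₁‖_{𝕋¹}` for a `2π`-periodic root selection.
[cite: BenfattoGiulianiMastropietro2003, §7.1 Lemma 7.1 (A1.9)] -/
theorem torusDist_normalAngleFn_le (hper : Function.Periodic u (2 * π)) (θ₁ θ₂ : ℝ) :
    torusDist ((θ₂ - Real.arctan (deriv u θ₂ / u θ₂)) - (θ₁ - Real.arctan (deriv u θ₁ / u θ₁))) ≤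
      (2 + ((4 + κ₂) * (B.smax + κ₁ * (π * Real.sqrt 2 + 2 * B.smax) / (B.Dtmin - κ₁)) ^ 2 +
        (8 + 2 * κ₁) * ((4 + κ₁) * (π * Real.sqrt 2) / (B.Dtmin - κ₁)) + (4 + κ₁) * (π * Real.sqrt 2)) / (B.Dtmin - κ₁) / B.umin) *
        torusDist (θ₂ - θ₁) := by
  obtain ⟨k, hk⟩ := exists_torusDist_eq_abs (θ₂ - θ₁)
  have hshift := normalAngleFn_add_int_mul_two_pi hper θ₂ k
  have hlip := abs_normalAngleFn_sub_le B hδs hδ hlo hhi hκ hκ₁ hκ₂ hu θ₁ (θ₂ + k * (2 * π))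
  rw [hshift] at hlip
  have e1 : (θ₂ - Real.arctan (deriv u θ₂ / u θ₂)) + k * (2 * π) - (θ₁ - Real.arctan (deriv u θ₁ / u θ₁)) =
      ((θ₂ - Real.arctan (deriv u θ₂ / u θ₂)) - (θ₁ - Real.arctan (deriv u θ₁ / u θ₁))) + k * (2 * π) := by ring
  have e2 : θ₂ + k * (2 * π) - θ₁ = θ₂ - θ₁ + k * (2 * π) := by ring
  rw [e1, e2, ← hk] at hlip
  calc _ = torusDist (((θ₂ - Real.arctan (deriv u θ₂ / u θ₂)) - (θ₁ - Real.arctan (deriv u θ₁ / u θ₁))) + k * (2 * π)) :=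
        (torusDist_add_int_mul_two_pi _ k).symm
    _ ≤ |((θ₂ - Real.arctan (deriv u θ₂ / u θ₂)) - (θ₁ - Real.arctan (deriv u θ₁ / u θ₁))) + k * (2 * π)| := torusDist_le_abs_self _
    _ ≤ _ := hlip

end Root

/-! ## §3 In BGM 2003's vocabulary: the chart `u₂ θ e := perturbedFermiRadius δ (μ + e) θ` at `e = 0` -/

section Chart

variable {a b : ℝ} (B : BandBounds a b) {δ : (Fin 2 → ℝ) → ℝ} (hδs : ContDiff ℝ 2 δ) (heven : ∀ k, δ (-k) = δ k)
  {κ₀ κ₁ κ₂ μ : ℝ} (hδ : ∀ k : Fin 2 → ℝ, (∀ i, |k i| ≤ π) → |δ k| ≤ κ₀) (hlo : a ≤ μ - κ₀) (hhi : μ + κ₀ ≤ b)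
  (hκ : ∀ k : Fin 2 → ℝ, (∀ i, |k i| ≤ π) → ‖fderiv ℝ δ k‖ ≤ κ₁) (hκ₁ : κ₁ < B.Dtmin)
  (hκ₂ : ∀ k : Fin 2 → ℝ, (∀ i, |k i| ≤ π) → ‖fderiv ℝ (fderiv ℝ δ) k‖ ≤ κ₂)
include B hδs heven hδ hlo hhi hκ hκ₁ hκ₂

omit hδs heven hκ hκ₁ hκ₂ hδ hlo hhi B in
/-- The normal angle of the chart at `e = 0` is `θ − arctan(u′(θ)/u(θ))` with `u = perturbedFermiRadius δ μ`. [folklore] -/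
theorem normalAngle_perturbed_eq (θ : ℝ) :
    BGM2003.normalAngle (fun ϑ e => perturbedFermiRadius δ (μ + e) ϑ) θ 0 =
      θ - Real.arctan (deriv (perturbedFermiRadius δ μ) θ / perturbedFermiRadius δ μ θ) := by
  simp only [BGM2003.normalAngle, BGM2003.radiusDeriv, add_zero]

omit heven in
/-- **(u2), Lipschitz half**: `‖α(θ₂,0) − α(θ₁,0)‖_{𝕋¹} ≤ (2 + U₂/u_min)‖θ₂ − θ₁‖_{𝕋¹}` for the chart of the perturbed curve.
[cite: BenfattoGiulianiMastropietro2003, §7.1 Lemma 7.1 (A1.9)] -/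
theorem normalAngle_perturbed_lipschitz (θ₁ θ₂ : ℝ) :
    torusDist (BGM2003.normalAngle (fun ϑ e => perturbedFermiRadius δ (μ + e) ϑ) θ₂ 0 -
        BGM2003.normalAngle (fun ϑ e => perturbedFermiRadius δ (μ + e) ϑ) θ₁ 0) ≤
      (2 + ((4 + κ₂) * (B.smax + κ₁ * (π * Real.sqrt 2 + 2 * B.smax) / (B.Dtmin - κ₁)) ^ 2 +
        (8 + 2 * κ₁) * ((4 + κ₁) * (π * Real.sqrt 2) / (B.Dtmin - κ₁)) + (4 + κ₁) * (π * Real.sqrt 2)) / (B.Dtmin - κ₁) / B.umin) *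
        torusDist (θ₂ - θ₁) := by
  rw [normalAngle_perturbed_eq, normalAngle_perturbed_eq]
  have hu : ∀ θ, IsBandFermiRadius (μ - δ (perturbedFermiRadius δ μ θ • dir θ)) θ (perturbedFermiRadius δ μ θ) :=
    isBandFermiRadius_perturbedFermiRadius B hδs.continuous hδ hlo hhi
  exact torusDist_normalAngleFn_le B hδs hδ hlo hhi hκ hκ₁ hκ₂ hu (fun θ => perturbedFermiRadius_add_two_pi δ μ θ) θ₁ θ₂

omit B hδs hδ hlo hhi hκ hκ₁ hκ₂ in
/-- **(u2), half-turn half**: `α(θ + π, 0) = α(θ, 0) + π` for the chart of the perturbed curve (even `δ`).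
[cite: BenfattoGiulianiMastropietro2003, §7.1 Lemma 7.1 (A1.9)] -/
theorem normalAngle_perturbed_add_pi (θ : ℝ) :
    BGM2003.normalAngle (fun ϑ e => perturbedFermiRadius δ (μ + e) ϑ) (θ + π) 0 =
      BGM2003.normalAngle (fun ϑ e => perturbedFermiRadius δ (μ + e) ϑ) θ 0 + π := by
  rw [normalAngle_perturbed_eq, normalAngle_perturbed_eq]
  exact normalAngleFn_add_pi (u := perturbedFermiRadius δ μ) (fun θ => perturbedFermiRadius_add_pi heven μ θ) θ

end Chart

end Summit.HubbardSuperconductivity.HubbardSuperconductivity.Theorems.PerturbedFermiCurve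

end
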